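import Mathlib
import Summits.CriticalPhenomena.CardyFormulaZ2.Theorems.CardySelfRefinementRussoDriftPolynomial
import Summits.CriticalPhenomena.CardyFormulaZ2.Theorems.CardySelfRefinementRussoDriftReparam
import Summits.CriticalPhenomena.CardyFormulaZ2.Theorems.CardySelfRefinementRussoDriftForcedTangency
import HarnessLib

/-!
# `RussoDrift` (item stmt-CriticalPhenomena-10271 of route `CardySelfRefinement`): forced tangency

Closes the support item `RussoDrift` of
`Summits/CriticalPhenomena/CardyFormulaZ2/Theses/CardySelfRefinement.lean`:
`TrivialSectorRate → CriticalPathRSW → GradientComparability →` for `k = 2, 3` and every finite quad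
family `F`, `P k m F η 1 0 − P k m F η 0 ½ → 0` as `η → 0⁺` (the joint crossing probabilities of the
self-refinement model `M_k` at its two Bernoulli endpoints — bond-`ℤ²` at meshes `kη` and `η` —
merge).

Proof (`russoDrift_proof`).  Empty family: `P ≡ 1` (`P_zero`).  Otherwise: `CriticalPathRSW` gives a
continuous BV path `γ : (1,0) → (0,½)` in `[0,1]²`; `TrivialSectorRate` a continuous nonvanishing
direction field `κ` with `|κ₂ ∂ρP − κ₁ ∂cP| ≤ C η^θ` along `γ`; `GradientComparability` comparability
and uniform divergence of `|∂ρP| + |∂cP|` along `γ`.  `P` is a polynomial on the square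
(`exists_contDiff_eq_P`), so the one-sided `derivWithin`s `Dρ, Dc` are the partial derivatives of a
`C¹` function (`Dρ_eq_fderiv`, `Dc_eq_fderiv`); extend `γ, κ` to `ℝ` by the clamp `projIcc`,
reparametrise `γ` by its total variation (`exists_lipschitz_reparam`: monotone section `σ`,
`1`-Lipschitz coordinates, endpoints kept), normalise `κ` to a unit field; for small `η` the
tangential component `u · ∇P` is continuous and nonvanishing along the path (Lagrange identity:
`(u·g)² = |g|² − (u^⊥·g)² ≥ |g|²/2 − 1 > 0`), hence of constant sign (intermediate value theorem);
the abstract forced-tangency theorem `tendsto_sub_of_forced_tangency` then gives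
`P(γ 1) − P(γ 0) → 0`.
-/

noncomputable section

namespace Summit.CriticalPhenomena.CardyFormulaZ2.Theorems

open scoped Topology
open Set Filter MeasureTheory
open Literature.Probability.LatticeModels Literature.Probability.Percolation
open Literature.Probability.Percolation.QuadCrossing
open Summit.CriticalPhenomena.CardyFormulaZ2.Theses.CardySelfRefinement
open Summit.CriticalPhenomena.CardyFormulaZ2.Theorems.CardySelfRefinement
open Summit.CriticalPhenomena.CardyFormulaZ2.Theorems.RussoDrift

/-- Identification of the one-sided Russo derivative in `ρ` with the partial derivative of the
polynomial representative `Φ` of `P` on the square. -/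
theorem Dρ_eq_fderiv {k m : ℕ} {F : Fin m → Quad (Set.univ : Set ℂ)} {η : ℝ} {Φ : ℝ × ℝ → ℝ}
    (hΦ : ContDiff ℝ 1 Φ)
    (hP : ∀ ρ ∈ Set.Icc (0 : ℝ) 1, ∀ c ∈ Set.Icc (0 : ℝ) 1, P k m F η ρ c = Φ (ρ, c))
    {ρ c : ℝ} (hρ : ρ ∈ Set.Icc (0 : ℝ) 1) (hc : c ∈ Set.Icc (0 : ℝ) 1) :
    Dρ k m F η (ρ, c) = fderiv ℝ Φ (ρ, c) (1, 0) := by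
  have h1 : HasDerivAt (fun ρ' : ℝ => Φ (ρ', c)) (fderiv ℝ Φ (ρ, c) (1, 0)) ρ := by
    have hΦd : HasFDerivAt Φ (fderiv ℝ Φ (ρ, c)) (ρ, c) :=
      (hΦ.differentiable one_ne_zero _).hasFDerivAt
    have hl : HasDerivAt (fun ρ' : ℝ => (ρ', c)) ((1 : ℝ), (0 : ℝ)) ρ :=
      (hasDerivAt_id ρ).prodMk (hasDerivAt_const ρ c)
    exact hΦd.comp_hasDerivAt ρ hl
  have h2 : derivWithin (fun ρ' => P k m F η ρ' c) (Set.Icc 0 1) ρ =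
      derivWithin (fun ρ' => Φ (ρ', c)) (Set.Icc 0 1) ρ :=
    derivWithin_congr (fun ρ' hρ' => hP ρ' hρ' c hc) (hP ρ hρ c hc)
  show derivWithin (fun ρ' => P k m F η ρ' c) (Set.Icc 0 1) ρ = _
  rw [h2]
  exact h1.hasDerivWithinAt.derivWithin (uniqueDiffOn_Icc zero_lt_one ρ hρ)

/-- Identification of the one-sided Russo derivative in `c` with the partial derivative of the
polynomial representative `Φ` of `P` on the square. -/
theorem Dc_eq_fderiv {k m : ℕ} {F : Fin m → Quad (Set.univ : Set ℂ)} {η : ℝ} {Φ : ℝ × ℝ → ℝ}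
    (hΦ : ContDiff ℝ 1 Φ)
    (hP : ∀ ρ ∈ Set.Icc (0 : ℝ) 1, ∀ c ∈ Set.Icc (0 : ℝ) 1, P k m F η ρ c = Φ (ρ, c))
    {ρ c : ℝ} (hρ : ρ ∈ Set.Icc (0 : ℝ) 1) (hc : c ∈ Set.Icc (0 : ℝ) 1) :
    Dc k m F η (ρ, c) = fderiv ℝ Φ (ρ, c) (0, 1) := by
  have h1 : HasDerivAt (fun c' : ℝ => Φ (ρ, c')) (fderiv ℝ Φ (ρ, c) (0, 1)) c := by
    have hΦd : HasFDerivAt Φ (fderiv ℝ Φ (ρ, c)) (ρ, c) :=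
      (hΦ.differentiable one_ne_zero _).hasFDerivAt
    have hl : HasDerivAt (fun c' : ℝ => (ρ, c')) ((0 : ℝ), (1 : ℝ)) c :=
      (hasDerivAt_const c ρ).prodMk (hasDerivAt_id c)
    exact hΦd.comp_hasDerivAt c hl
  have h2 : derivWithin (fun c' => P k m F η ρ c') (Set.Icc 0 1) c =
      derivWithin (fun c' => Φ (ρ, c')) (Set.Icc 0 1) c :=
    derivWithin_congr (fun c' hc' => hP ρ hρ c' hc') (hP ρ hρ c hc)
  show derivWithin (fun c' => P k m F η ρ c') (Set.Icc 0 1) c = _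
  rw [h2]
  exact h1.hasDerivWithinAt.derivWithin (uniqueDiffOn_Icc zero_lt_one c hc)

/-- **`RussoDrift` (item stmt-CriticalPhenomena-10271, route `CardySelfRefinement`): forced
tangency.**  `TrivialSectorRate → CriticalPathRSW → GradientComparability →` for `k = 2, 3` and
every finite quad family the joint crossing probabilities under `M_k(1,0)` and `M_k(0,½)` at the
same mesh differ by `o(1)` as `η → 0⁺`.

Proof: for the empty family `P ≡ 1`.  Otherwise take the RSW path `γ` (`CriticalPathRSW`), the
direction field `κ` with the `O(η^θ)` tangency bound (`TrivialSectorRate`) and the comparability /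
divergence of the gradient (`GradientComparability`).  `P` is a polynomial on `[0,1]²`
(`exists_contDiff_eq_P`), so `Dρ, Dc` are honest partial derivatives (`Dρ_eq_fderiv`,
`Dc_eq_fderiv`); reparametrise `γ` by total variation (`exists_lipschitz_reparam`), normalise `κ`,
note that the tangential component of the gradient is continuous and nonvanishing along the
path for small `η`, hence of constant sign (intermediate value theorem), and apply the abstract
forced-tangency theorem `tendsto_sub_of_forced_tangency`. -/
theorem russoDrift_proof : RussoDrift := by
  rw [russoDrift_iff]
  intro hT hC hG k hk m F
  rcases Nat.eq_zero_or_pos m with rfl | hm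
  · simp only [P_zero, sub_self]
    exact tendsto_const_nhds
  obtain ⟨γ, hγ⟩ := criticalPathRSW_iff.1 hC k hk
  obtain ⟨θ, hθ, κ₁, κ₂, hκ₁, hκ₂, hκ0, C, η₀, hη₀, hTSR⟩ := trivialSectorRate_iff.1 hT k hk γ hγ m F
  obtain ⟨Λ, η₀', hη₀', hcomp, hdiv⟩ := gradientComparability_iff.1 hG k hk γ hγ m F hm
  obtain ⟨hγc, hγ0, hγ1, hγsq, hBV₁, hBV₂, -⟩ := hγ
  -- extend everything to `ℝ` through the clamp `pI`
  set pI : ℝ → unitInterval := Set.projIcc (0 : ℝ) 1 zero_le_one with hpI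
  have hpIc : Continuous pI := continuous_projIcc
  have hpIm : Monotone pI := Set.monotone_projIcc _
  set γ' : ℝ → ℝ × ℝ := fun x => γ (pI x) with hγ'
  have hγ'c : Continuous γ' := hγc.comp hpIc
  have hBV : ∀ f : unitInterval → ℝ, BoundedVariationOn f Set.univ →
      BoundedVariationOn (fun x => f (pI x)) Set.univ := by
    intro f hf
    have h := eVariationOn.comp_eq_of_monotoneOn f pI (hpIm.monotoneOn Set.univ)
    refine ne_top_of_le_ne_top hf ?_
    rw [show (fun x => f (pI x)) = f ∘ pI from rfl, h]
    exact eVariationOn.mono _ (Set.subset_univ _)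
  have hBV₁' : BoundedVariationOn (fun x => (γ' x).1) Set.univ := hBV (fun s => (γ s).1) hBV₁
  have hBV₂' : BoundedVariationOn (fun x => (γ' x).2) Set.univ := hBV (fun s => (γ s).2) hBV₂
  obtain ⟨L, hL, σ, hσm, hσ0, hσL, hlip₁, hlip₂⟩ := exists_lipschitz_reparam γ' hγ'c hBV₁' hBV₂'
  -- the unit direction field
  set nrm : unitInterval → ℝ := fun s => Real.sqrt (κ₁ s ^ 2 + κ₂ s ^ 2) with hnrm
  have hnrm_c : Continuous nrm := (((hκ₁.pow 2).add (hκ₂.pow 2))).sqrt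
  have hnrm_pos : ∀ s, 0 < nrm s := by
    intro s
    apply Real.sqrt_pos.2
    rcases hκ0 s with h | h
    · have := sq_pos_of_ne_zero h; positivity
    · have := sq_pos_of_ne_zero h; positivity
  have hnrm_sq : ∀ s, nrm s ^ 2 = κ₁ s ^ 2 + κ₂ s ^ 2 := fun s =>
    Real.sq_sqrt (by positivity)
  obtain ⟨s₀, -, hs₀⟩ := isCompact_univ.exists_isMinOn Set.univ_nonempty hnrm_c.continuousOn
  set nmin : ℝ := nrm s₀ with hnmin
  have hnmin0 : 0 < nmin := hnrm_pos s₀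
  have hnmin : ∀ s, nmin ≤ nrm s := fun s => hs₀ (Set.mem_univ s)
  set u₀ : unitInterval → ℝ × ℝ := fun s => (κ₁ s / nrm s, κ₂ s / nrm s) with hu₀
  have hu₀c : Continuous u₀ :=
    (hκ₁.div hnrm_c fun s => (hnrm_pos s).ne').prodMk (hκ₂.div hnrm_c fun s => (hnrm_pos s).ne')
  have hu₀n : ∀ s, (u₀ s).1 ^ 2 + (u₀ s).2 ^ 2 = 1 := by
    intro s
    simp only [hu₀]
    rw [div_pow, div_pow, ← add_div, ← hnrm_sq, div_self (pow_ne_zero 2 (hnrm_pos s).ne')]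
  set u : ℝ → ℝ × ℝ := fun t => u₀ (pI (σ t)) with hu
  have hum : Measurable u := (hu₀c.comp hpIc).measurable.comp hσm.measurable
  have hun : ∀ t, (u t).1 ^ 2 + (u t).2 ^ 2 = 1 := fun t => hu₀n _
  -- the polynomial representatives of `P`
  have hΦex : ∀ η : ℝ, ∃ Φ : ℝ × ℝ → ℝ, η ≠ 0 → ContDiff ℝ 1 Φ ∧
      ∀ ρ ∈ Set.Icc (0 : ℝ) 1, ∀ c ∈ Set.Icc (0 : ℝ) 1, P k m F η ρ c = Φ (ρ, c) := by
    intro η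
    by_cases hη : η = 0
    · exact ⟨fun _ => 0, fun h => (h hη).elim⟩
    · obtain ⟨Φ, hΦ⟩ := exists_contDiff_eq_P k m F hη
      exact ⟨Φ, fun _ => hΦ⟩
  choose Φ hΦ using hΦex
  have hΦd : ∀ η : ℝ, 0 < η → ContDiff ℝ 1 (Φ η) := fun η hη => (hΦ η hη.ne').1
  have hΦP : ∀ η : ℝ, 0 < η → ∀ ρ ∈ Set.Icc (0 : ℝ) 1, ∀ c ∈ Set.Icc (0 : ℝ) 1,
      P k m F η ρ c = Φ η (ρ, c) := fun η hη => (hΦ η hη.ne').2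
  have hsq : ∀ s, (γ s).1 ∈ Set.Icc (0 : ℝ) 1 ∧ (γ s).2 ∈ Set.Icc (0 : ℝ) 1 := fun s =>
    Set.mem_prod.1 (hγsq s)
  -- the gradient along the extended path, identified with the partial derivatives of `Φ η`
  have hDρ : ∀ η : ℝ, 0 < η → ∀ x : ℝ, Dρ k m F η (γ' x) = fderiv ℝ (Φ η) (γ' x) (1, 0) := by
    intro η hη x
    have h := Dρ_eq_fderiv (hΦd η hη) (hΦP η hη) (hsq (pI x)).1 (hsq (pI x)).2
    simpa only [hγ', Prod.mk.eta] using h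
  have hDc : ∀ η : ℝ, 0 < η → ∀ x : ℝ, Dc k m F η (γ' x) = fderiv ℝ (Φ η) (γ' x) (0, 1) := by
    intro η hη x
    have h := Dc_eq_fderiv (hΦd η hη) (hΦP η hη) (hsq (pI x)).1 (hsq (pI x)).2
    simpa only [hγ', Prod.mk.eta] using h
  -- the error `ε η = |C| η^θ / nmin → 0`
  set ε : ℝ → ℝ := fun η => |C| * η ^ θ / nmin with hε
  have hεt : Tendsto ε (𝓝[>] 0) (𝓝 0) := by
    have h1 : Tendsto (fun η : ℝ => η ^ θ) (𝓝 0) (𝓝 0) := by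
      have := (Real.continuousAt_rpow_const 0 θ (Or.inr hθ.le)).tendsto
      simpa [Real.zero_rpow hθ.ne'] using this
    have h2 : Tendsto (fun η : ℝ => |C| * η ^ θ / nmin) (𝓝 0) (𝓝 (|C| * 0 / nmin)) :=
      (h1.const_mul |C|).div_const nmin
    rw [mul_zero, zero_div] at h2
    exact h2.mono_left nhdsWithin_le_nhds
  -- tangency bound along the extended path (any real parameter `x`)
  have hTx : ∀ η ∈ Set.Ioo 0 η₀, ∀ x : ℝ,
      |(u₀ (pI x)).2 * Dρ k m F η (γ' x) - (u₀ (pI x)).1 * Dc k m F η (γ' x)| ≤ ε η := by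
    intro η hη x
    have h := hTSR (pI x) η hη
    have hn := hnrm_pos (pI x)
    have hrew : (u₀ (pI x)).2 * Dρ k m F η (γ' x) - (u₀ (pI x)).1 * Dc k m F η (γ' x) =
        (κ₂ (pI x) * Dρ k m F η (γ (pI x)) - κ₁ (pI x) * Dc k m F η (γ (pI x))) / nrm (pI x) := by
      simp only [hu₀, hγ']
      field_simp
    rw [hrew, abs_div, abs_of_pos hn, div_le_iff₀ hn]
    have hηθ : 0 ≤ η ^ θ := Real.rpow_nonneg hη.1.le θ
    calc |κ₂ (pI x) * Dρ k m F η (γ (pI x)) - κ₁ (pI x) * Dc k m F η (γ (pI x))| ≤ C * η ^ θ := h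
      _ ≤ |C| * η ^ θ := mul_le_mul_of_nonneg_right (le_abs_self C) hηθ
      _ = ε η * nmin := by simp only [hε]; field_simp
      _ ≤ ε η * nrm (pI x) := mul_le_mul_of_nonneg_left (hnmin (pI x)) (by simp only [hε]; positivity)
  -- small meshes: `ε η < 1` and gradient size `≥ 2`, within both `η₀` and `η₀'`
  obtain ⟨η₂, hη₂, hε2⟩ := (nhdsGT_basis (0 : ℝ)).eventually_iff.1 (hεt.eventually (gt_mem_nhds one_pos))
  obtain ⟨η₃, hη₃, hdiv2⟩ := hdiv 2
  set ηm : ℝ := min (min η₀ η₀') (min η₂ η₃) with hηm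
  have hηm0 : 0 < ηm := by positivity
  have hηm_sub : ∀ η ∈ Set.Ioo 0 ηm,
      η ∈ Set.Ioo 0 η₀ ∧ η ∈ Set.Ioo 0 η₀' ∧ η ∈ Set.Ioo 0 η₂ ∧ η ∈ Set.Ioo 0 η₃ := by
    intro η hη
    have h1 : ηm ≤ η₀ := (min_le_left _ _).trans (min_le_left _ _)
    have h2 : ηm ≤ η₀' := (min_le_left _ _).trans (min_le_right _ _)
    have h3 : ηm ≤ η₂ := (min_le_right _ _).trans (min_le_left _ _)
    have h4 : ηm ≤ η₃ := (min_le_right _ _).trans (min_le_right _ _)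
    exact ⟨⟨hη.1, hη.2.trans_le h1⟩, ⟨hη.1, hη.2.trans_le h2⟩, ⟨hη.1, hη.2.trans_le h3⟩,
      ⟨hη.1, hη.2.trans_le h4⟩⟩
  -- constant sign of the tangential component (IVT on the continuous extended path)
  have hsign : ∀ η ∈ Set.Ioo 0 ηm,
      (∀ x : ℝ, 0 < (u₀ (pI x)).1 * Dρ k m F η (γ' x) + (u₀ (pI x)).2 * Dc k m F η (γ' x)) ∨
      (∀ x : ℝ, (u₀ (pI x)).1 * Dρ k m F η (γ' x) + (u₀ (pI x)).2 * Dc k m F η (γ' x) < 0) := by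
    intro η hη
    obtain ⟨h0, h0', h2, h3⟩ := hηm_sub η hη
    set lam : ℝ → ℝ := fun x =>
      (u₀ (pI x)).1 * Dρ k m F η (γ' x) + (u₀ (pI x)).2 * Dc k m F η (γ' x) with hlam
    have hG₁c : Continuous fun x => Dρ k m F η (γ' x) :=
      continuous_of_eq_fderiv (hΦd η h0.1) hγ'c (1, 0) (hDρ η h0.1)
    have hG₂c : Continuous fun x => Dc k m F η (γ' x) :=
      continuous_of_eq_fderiv (hΦd η h0.1) hγ'c (0, 1) (hDc η h0.1)
    have hu₀pc : Continuous fun x => u₀ (pI x) := hu₀c.comp hpIc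
    have hlamc : Continuous lam :=
      ((continuous_fst.comp hu₀pc).mul hG₁c).add ((continuous_snd.comp hu₀pc).mul hG₂c)
    have hne : ∀ x, lam x ≠ 0 := by
      intro x
      have hGx : 2 ≤ |Dρ k m F η (γ' x)| + |Dc k m F η (γ' x)| := hdiv2 η h3 (pI x)
      have hperp : ((u₀ (pI x)).2 * Dρ k m F η (γ' x) - (u₀ (pI x)).1 * Dc k m F η (γ' x)) ^ 2 ≤ 1 :=
        (sq_le_one_iff_abs_le_one _).2 ((hTx η h0 x).trans (hε2 h2).le)
      have hlag : lam x ^ 2 +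
          ((u₀ (pI x)).2 * Dρ k m F η (γ' x) - (u₀ (pI x)).1 * Dc k m F η (γ' x)) ^ 2 =
          Dρ k m F η (γ' x) ^ 2 + Dc k m F η (γ' x) ^ 2 := by
        simp only [hlam]
        linear_combination (Dρ k m F η (γ' x) ^ 2 + Dc k m F η (γ' x) ^ 2) * hu₀n (pI x)
      have hsq2 : (|Dρ k m F η (γ' x)| + |Dc k m F η (γ' x)|) ^ 2 ≤
          2 * (Dρ k m F η (γ' x) ^ 2 + Dc k m F η (γ' x) ^ 2) := by
        nlinarith [sq_nonneg (|Dρ k m F η (γ' x)| - |Dc k m F η (γ' x)|),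
          sq_abs (Dρ k m F η (γ' x)), sq_abs (Dc k m F η (γ' x))]
      have h4 : (2 : ℝ) ^ 2 ≤ (|Dρ k m F η (γ' x)| + |Dc k m F η (γ' x)|) ^ 2 :=
        pow_le_pow_left₀ zero_le_two hGx 2
      intro h0x
      rw [h0x] at hlag
      nlinarith
    by_contra hcon
    rw [not_or, not_forall, not_forall] at hcon
    obtain ⟨⟨x₁, hx₁⟩, ⟨x₂, hx₂⟩⟩ := hcon
    have hx₁' : lam x₁ ≤ 0 := not_lt.1 hx₁
    have hx₂' : 0 ≤ lam x₂ := not_lt.1 hx₂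
    obtain ⟨x, hx⟩ := intermediate_value_univ x₁ x₂ hlamc ⟨hx₁', hx₂'⟩
    exact hne x hx
  -- apply the abstract forced-tangency theorem to the reparametrised data
  have hmain := tendsto_sub_of_forced_tangency (L := L) (η₀ := ηm) hL hηm0 hlip₁ hlip₂ hum hun
    (Φ := Φ) (fun η hη => hΦd η hη.1)
    (fun η hη t => by
      obtain ⟨h0, -⟩ := hηm_sub η hη
      show Φ η (γ' (σ t)) ∈ Set.Icc (0 : ℝ) 1
      rw [show γ' (σ t) = ((γ (pI (σ t))).1, (γ (pI (σ t))).2) from rfl,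
        ← hΦP η h0.1 _ (hsq _).1 _ (hsq _).2]
      exact ⟨P_nonneg k m F η _ _, P_le_one k m F η _ _⟩)
    (g₁ := fun η t => Dρ k m F η (γ' (σ t))) (g₂ := fun η t => Dc k m F η (γ' (σ t)))
    (fun η hη t => hDρ η hη.1 (σ t)) (fun η hη t => hDc η hη.1 (σ t)) hεt
    (fun η hη t => hTx η (hηm_sub η hη).1 (σ t))
    (Λ := Λ) (fun η hη t t' => hcomp (pI (σ t)) (pI (σ t')) η (hηm_sub η hη).2.1)
    (fun N => by
      obtain ⟨η₁, hη₁, h⟩ := hdiv N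
      exact ⟨η₁, hη₁, fun η hη t => h η hη (pI (σ t))⟩)
    (fun η hη => by
      rcases hsign η hη with h | h
      · exact Or.inl fun t => h (σ t)
      · exact Or.inr fun t => h (σ t))
  -- read off the endpoints
  have hend0 : γ' (σ 0) = (1, 0) := by
    rw [hσ0]; show γ (pI 0) = (1, 0); rw [show pI 0 = 0 from Set.projIcc_left _, hγ0]
  have hendL : γ' (σ L) = (0, 1 / 2) := by
    rw [hσL]; show γ (pI 1) = (0, 1 / 2); rw [show pI 1 = 1 from Set.projIcc_right _, hγ1]
  rw [hendL, hend0] at hmain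
  have hev : (fun η => Φ η (0, 1 / 2) - Φ η (1, 0)) =ᶠ[𝓝[>] 0]
      fun η => -(P k m F η 1 0 - P k m F η 0 (1 / 2)) := by
    filter_upwards [self_mem_nhdsWithin] with η hη
    have hη' : 0 < η := hη
    rw [hΦP η hη' 1 ⟨zero_le_one, le_rfl⟩ 0 ⟨le_rfl, zero_le_one⟩,
      hΦP η hη' 0 ⟨le_rfl, zero_le_one⟩ (1 / 2) ⟨by norm_num, by norm_num⟩]
    ring
  have := (hmain.congr' hev).neg
  simpa using this

end Summit.CriticalPhenomena.CardyFormulaZ2.Theorems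

end
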